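import Summits.QuantumFields.YangMills.Theorems.BalabanUVNodesN09ChartLettersAnalytic
import Literature.MathematicalPhysics.QuantumFieldTheory.Balaban1983to89.T4FixedPointResponse

/-!
# NODE N09 [B12] — THE SECOND-ORDER INPUTS (J2)×2, (J3) OF THE BY-REFERENCE RESIDUE `JInputsRef` AT THE CHART PIN: `hS`, `hSτ`, `hA2` for the charted letters
# `𝐇 − H₁ = ev(𝓗(𝔄) − 𝔄)`, `𝐊 − τH₁ = ev(𝓗(τ𝔄) − τ𝔄)`, `𝐀₂ = ev(𝓗(τ𝔄 + H_{1,j}B′) − 𝓗(τ𝔄))` from the EQUATION (175) `𝒜 = −𝔊W(𝒜 + 𝔄)` ([15]),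
# the regime, and DISPLAYED smoothing laws for `𝔊`, `T − id = −HD`, `H_{1,j}` in the `∂^{ξ*}π∂^ξ`-currency (N06∕N07 in-edges) — the route print names on p. 279

WIDTH SEAT `pub-ymgap-dag-n09-w1` (g0, 2026-08-27; HUMAN RULING D-0149; plan g77 `W-SEAT-START-LIST.md` §n09 ITEM 1 «instantiate the by-reference package fields at the
objects, one field per file» — third field-file: the (J2)∕(J3) fields; key K1⁷ `stmt-QuantumFields-20542`, `--supports`, COUNT-NEUTRAL helper).  APPEND-ONLY GROWTH: a NEW
importing module; my `…N09ChartLettersAnalytic` (p584202; hence node00-def-B12 MODULE D `Node00/CarriersB12Chart`: `ChartB12Run`, `ChartB12Laws`, `JInputsRef`), lit p07∕r20 `B12Eq311RemainderQuadratic.lapCur_add∕_smul∕_sub`,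
`B12CondIIIJConcreteModels.lapCur_zero`, `B11Eq174Chart.Regime.eq175∕solA_mem`, `B11Eq120SolutionLipschitz.norm_solA_sub_solA_le_datum`, b2b `T4FixedPointResponse.quadAnalytic_norm_sub_le`
CONSUMED BY NAME; nothing landed is edited or retyped.

PRINT.  [I] = T. Bałaban, CMP **109** (1987), p. 279: *«The second inequality in this condition is obtained in the same way. We start with (3.42) and we use again the
formulas and the bounds (1.43)–(1.54) [14]. They give a bound of the type (3.44), but for the second order operator ∂^{ξ*}∂^ξ. Then the same reasoning as between (3.44)–(3.47)
gives the required second inequality in (iii)»*; (3.45) p. 279: *«the function 𝐇_j is given by (174) [15], i.e. 𝐇_j(□₀, B) = H_{1,j}B − H_jD_j(H_{1,j}B + 𝒜_{1,j}(B)), where the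
functions on the right-hand side are at least of second order, except the first term»*; (3.50) p. 280: *«|𝐀₂|, |∇^η𝐀₂| ≤ B₃|B′|»*.  [15] = CMP **102** (1985): (175) p. 305
`𝒜₁ + 𝔊((δ/δA′)V)(𝒜₁ + H₁B) = 0`; (117) p. 295 (*«By Theorem 3.13 of [5] the norm … of the transformation»* — `𝔊` gains two derivatives); (47) p. 287 (`T = id − HD`);
(103) p. 293 (`H₁`); (190) p. 308.  (J2), (J3) are lit p07's names (`B12CondIIIJ` header) for the `∂^{ξ*}∂^ξ`-analogues of (3.45) and of (3.50).

WHAT IS PROVED (kernel, sorry-free, theorems only).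
§1 (scheme level) `chartH_sub_self_eq` — under a regime, for `‖𝔄‖ < a`: `𝓗(𝔄) − 𝔄 = (T Y − Y) − 𝔊(W Y)`, `Y := 𝒜(𝔄) + 𝔄` ((174) + (175)); `norm_arg_chart_lt` (`‖Y‖ < ε₄ + a`),
   `norm_W_arg_le` (`‖W Y‖ ≤ C₄(ε₄ + a)²`); `chartH_sub_chartH_eq` — `𝓗(𝔄₁) − 𝓗(𝔄₀) = ((T Y₁ − Y₁) − (T Y₀ − Y₀)) − 𝔊(W Y₁ − W Y₀) + (𝔄₁ − 𝔄₀)`;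
   `norm_argDiff_le` (`‖Y₁ − Y₀‖ ≤ (κ∕(1 − κ) + 1)‖𝔄₁ − 𝔄₀‖`, r-b2b's datum-Lipschitz BY NAME); `norm_W_diff_le` ((119)–(120) BY NAME).
§2 AT A CHARTED RUN `χ` under `ChartB12Laws Rz cB χ` with the smoothing laws displayed: **`hS_of_chart`**, **`hSτ_of_chart`** — EXACTLY the `JInputsRef.hS ∕ .hSτ` texts at the charted
   letters (module D `ChartB12Inputs.inputsRef`'s codomain), from `lapG` (`‖∂^{ξ*}π∂^ξ ev(𝔊f)‖ ≤ B_G‖f‖`), `lapT` (`‖∂^{ξ*}π∂^ξ ev(TY − Y)‖ ≤ K_L‖Y‖²` on the ball) and ONE constant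
   line `(K_L + B_G C₄)(ε₄ + a)² < βα₀(L^{j−1}η)²` (the shape of module D's `h345`); **`hA2_of_chart`** — EXACTLY `JInputsRef.hA2` (`n = ‖B′‖`), from `lapG`, `lapTlip`
   (`‖∂^{ξ*}π∂^ξ ev((Tx − x) − (Ty − y))‖ ≤ K_L′‖x − y‖` on the ball), `lapLin` (`‖∂^{ξ*}π∂^ξ ev(H_{1,j}B′)‖ ≤ B_H‖B′‖`) and ONE constant line (the shape of module D's `h350`).
§3 `leaf_of_chart_of_smoothing` — ONE CLOSER for `B12LeafOfRecord Rz cB χ.toResid` (LEMMA 4 (3.53)) whose displayed hypotheses are the honest residue: chart laws, smoothing laws +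
   two constant lines, `W`∕`T`∕datum analyticity (my `…N09ChartLettersAnalytic`, p584202), «X ⊂ □̃²», the seven restrictions, `0 < cB`, and `JInputsRef` MODULO its three size
   fields (a function receiving the (J2)×2∕(J3) sizes proved in §2).

HONEST SCOPE ∕ A6 (№189).  (a) What moved: the three second-order SIZE fields of `JInputsRef` are theorems at the chart pin; what replaces them are FOUR displayed smoothing laws in
print's own currency — `𝔊 = G̃` gains two derivatives ([15] (117) citing [5] Thm 3.13 = N06's [B9]), `T − id = −HD` is of second order AND Lipschitz in the `∂^{ξ*}π∂^ξ`-seminorm ([15] (47),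
(190)), `H_{1,j}` maps into that seminorm ([15] (103)) — plus two constant lines; exactly the mechanism print names on p. 279 («the bounds (1.43)–(1.54) [14] … for the second order
operator»; «(174) [15] … at least of second order»).  (b) What did NOT move: the laws themselves (N06∕N07 in-edges at NODE 00's objects; no tree object for `𝔊`, `H`, `D`, `H_{1,j}`
at the record), the rest of `JInputsRef` (upper-space datum (3.40), gauge transformations∕costs, identities (3.38)∕(3.39)∕(3.42)), the 13 datum-free chart laws; N09 is NOT
discharged; counts unmoved (typed 28∕28 · discharged 5∕27).  `Rz`-GENERIC: every theorem holds for an arbitrary residual recipe `Rz` and reads none of the identity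
fields (3.38)∕(3.39)+(3.37)∕(3.42) of `JInputsRef` — neither touched by nor an answer to dag-ref-L's SECOND-GAP-1 (pub-ymgap INBOX 2026-08-27T23:23Z: at the unit recipe those
identity fields force FLAT letters; cure = def-T's pin of `Rz.bgI`).  (c) Satisfiability: the laws hold jointly at module D's zero scheme (`𝔊 = 0`, `W = 0`, `T = id`, `ev = 0`, `H_{1,j} = 0`,
`lapCur … 0 = 0`) with `B_G = K_L = K_L′ = B_H = 0` and the constant lines reading `0 < βα₀(L^{j−1}η)²`, `0 ≤ B₃″` — physically vacuous sanity only, NOT the objects of record.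
One finite 𝕋⁴ programme at fixed `ε = L^{−K}`, Bałaban AS PRINTED; the Yang–Mills mass gap (Clay) is NOT proved by any of this — R4 closes the conditional finite-𝕋⁴ rung
`BalabanLadder.UV` only; nothing continuum ∕ ℝ⁴ ∕ infinite volume ∕ OS ∕ mass gap ∕ Clay.  No `sorry`, no `axiom`, no `def`, no `instance`, no `notation`.
-/

noncomputable section

namespace Summit.QuantumFields.YangMills.BalabanUVNodes.N09ChartSecondOrderInputs

open Metric Set
open Literature.MathematicalPhysics.QuantumFieldTheory.Balaban1983to89
open Literature.MathematicalPhysics.QuantumFieldTheory.Balaban1983to89.Node00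
open B12RegularSpaces111 (space)
open B12RegularSpaces111SpecialUnitary (suModel)
open B12Lemma4Models (slProj)
open B12Eq311CurrentExpansion (lapCur)
open B12Eq311RemainderQuadratic (lapCur_add lapCur_smul lapCur_sub)
open B12CondIIIJConcreteModels (lapCur_zero)
open B11Prop6Scheme (norm_arg_lt)
open B11Eq174Chart (Regime solA chartH chartH_def)
open B11Eq120SolutionLipschitz (norm_solA_sub_solA_le_datum)
open T4FixedPointResponse (quadAnalytic_norm_sub_le)
open Summit.QuantumFields.YangMills.BalabanUVNodes (N09ChartLettersAnalytic.leaf_of_chart_of_analytic)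
open scoped Matrix.Norms.L2Operator

/-! ## §1. Scheme level: `𝓗(𝔄) − 𝔄 = (TY − Y) − 𝔊(WY)` with `Y = 𝒜(𝔄) + 𝔄`, and the sizes of `Y`, `WY`, `Y₁ − Y₀`, `WY₁ − WY₀` -/

section Scheme

variable {𝒴 𝒵 : Type*} [NormedAddCommGroup 𝒴] [NormedSpace ℂ 𝒴] [NormedAddCommGroup 𝒵] [NormedSpace ℂ 𝒵] [CompleteSpace 𝒴]
  {𝒢 : 𝒵 →L[ℂ] 𝒴} {W : 𝒴 → 𝒵} {T : 𝒴 → 𝒴} {B₀ θ C₄ a₃ j a ε₄ : ℝ}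

/-- **(174) + (175): the second-order part of the chart** — `𝓗(𝔄) − 𝔄 = (T Y − Y) − 𝔊(W Y)` with `Y := 𝒜(𝔄) + 𝔄`, since `𝓗(𝔄) = T(Y)` ((174)) and `𝒜 = −𝔊W(Y)` ((175)).
[cite: Balaban1985Variational, (174)-(175) p.305] [cite: Balaban1987RG1, (3.45) p.279] -/
theorem chartH_sub_self_eq (R : Regime 𝒢 0 W B₀ θ C₄ a₃ j a ε₄) (hj : 0 ≤ j) {𝔄 : 𝒴} (h𝔄 : ‖𝔄‖ < a) :
    chartH 𝒢 0 W 0 T ε₄ 𝔄 - 𝔄 =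
      (T (solA 𝒢 0 W 0 ε₄ 𝔄 + 𝔄) - (solA 𝒢 0 W 0 ε₄ 𝔄 + 𝔄)) - 𝒢 (W (solA 𝒢 0 W 0 ε₄ 𝔄 + 𝔄)) := by
  have h175 := R.eq175 hj h𝔄
  have h𝒢 : 𝒢 (W (solA 𝒢 0 W 0 ε₄ 𝔄 + 𝔄)) = -solA 𝒢 0 W 0 ε₄ 𝔄 := eq_neg_of_add_eq_zero_right h175
  rw [chartH_def, h𝒢]
  abel

/-- `‖𝒜(𝔄) + 𝔄‖ < ε₄ + a` (the ball of (118)). [cite: Balaban1985Variational, (118) p.295] -/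
theorem norm_arg_chart_lt (R : Regime 𝒢 0 W B₀ θ C₄ a₃ j a ε₄) (hj : 0 ≤ j) {𝔄 : 𝒴} (h𝔄 : ‖𝔄‖ < a) :
    ‖solA 𝒢 0 W 0 ε₄ 𝔄 + 𝔄‖ < ε₄ + a :=
  norm_arg_lt h𝔄 (R.solA_mem (J := 0) (by simpa using hj) h𝔄).1

/-- `‖W(𝒜(𝔄) + 𝔄)‖ ≤ C₄(ε₄ + a)²` (Prop. 4's quadratic bound on the ball `ε₄ + a ≤ a₃∕2`). [cite: Balaban1985Variational, Prop. 4 (98) p.293, (117) p.295] -/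
theorem norm_W_arg_le (R : Regime 𝒢 0 W B₀ θ C₄ a₃ j a ε₄) (hj : 0 ≤ j) {𝔄 : 𝒴} (h𝔄 : ‖𝔄‖ < a) :
    ‖W (solA 𝒢 0 W 0 ε₄ 𝔄 + 𝔄)‖ ≤ C₄ * (ε₄ + a) ^ 2 := by
  have hY := norm_arg_chart_lt R hj h𝔄
  have ha : 0 < a := (norm_nonneg _).trans_lt h𝔄
  have hY3 : ‖solA 𝒢 0 W 0 ε₄ 𝔄 + 𝔄‖ < a₃ := by linarith [R.dom, R.ε₄_nonneg]
  have hq := R.quad.quad _ hY3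
  have h0 : 0 ≤ ‖solA 𝒢 0 W 0 ε₄ 𝔄 + 𝔄‖ := norm_nonneg _
  calc ‖W (solA 𝒢 0 W 0 ε₄ 𝔄 + 𝔄)‖ ≤ C₄ * ‖solA 𝒢 0 W 0 ε₄ 𝔄 + 𝔄‖ ^ 2 := hq
    _ ≤ C₄ * (ε₄ + a) ^ 2 := by
        have := R.C₄_nonneg
        gcongr

/-- **The increment of the chart between two data** — `𝓗(𝔄₁) − 𝓗(𝔄₀) = ((TY₁ − Y₁) − (TY₀ − Y₀)) − 𝔊(WY₁ − WY₀) + (𝔄₁ − 𝔄₀)`, `Yᵢ := 𝒜(𝔄ᵢ) + 𝔄ᵢ` ((174), (175) twice).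
[cite: Balaban1985Variational, (174)-(175) p.305] [cite: Balaban1987RG1, (3.50) p.279] -/
theorem chartH_sub_chartH_eq (R : Regime 𝒢 0 W B₀ θ C₄ a₃ j a ε₄) (hj : 0 ≤ j) {𝔄₁ 𝔄₀ : 𝒴} (h𝔄₁ : ‖𝔄₁‖ < a) (h𝔄₀ : ‖𝔄₀‖ < a) :
    chartH 𝒢 0 W 0 T ε₄ 𝔄₁ - chartH 𝒢 0 W 0 T ε₄ 𝔄₀ =
      ((T (solA 𝒢 0 W 0 ε₄ 𝔄₁ + 𝔄₁) - (solA 𝒢 0 W 0 ε₄ 𝔄₁ + 𝔄₁)) - (T (solA 𝒢 0 W 0 ε₄ 𝔄₀ + 𝔄₀) - (solA 𝒢 0 W 0 ε₄ 𝔄₀ + 𝔄₀)))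
        - 𝒢 (W (solA 𝒢 0 W 0 ε₄ 𝔄₁ + 𝔄₁) - W (solA 𝒢 0 W 0 ε₄ 𝔄₀ + 𝔄₀)) + (𝔄₁ - 𝔄₀) := by
  have e₁ := chartH_sub_self_eq (T := T) R hj h𝔄₁
  have e₀ := chartH_sub_self_eq (T := T) R hj h𝔄₀
  have : chartH 𝒢 0 W 0 T ε₄ 𝔄₁ - chartH 𝒢 0 W 0 T ε₄ 𝔄₀ =
      (chartH 𝒢 0 W 0 T ε₄ 𝔄₁ - 𝔄₁) - (chartH 𝒢 0 W 0 T ε₄ 𝔄₀ - 𝔄₀) + (𝔄₁ - 𝔄₀) := by abel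
  rw [this, e₁, e₀, map_sub]
  abel

/-- **`‖Y₁ − Y₀‖ ≤ (κ∕(1 − κ) + 1)‖𝔄₁ − 𝔄₀‖`**, `κ = θ + 4B₀C₄(ε₄ + a)` — the solution is `κ∕(1−κ)`-Lipschitz in the datum (b2b's `norm_solA_sub_solA_le_datum` BY NAME).
[cite: Balaban1985Variational, Prop. 6 (119)-(121) p.295] -/
theorem norm_argDiff_le (R : Regime 𝒢 0 W B₀ θ C₄ a₃ j a ε₄) (hj : 0 ≤ j) {𝔄₁ 𝔄₀ : 𝒴} (h𝔄₁ : ‖𝔄₁‖ < a) (h𝔄₀ : ‖𝔄₀‖ < a) :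
    ‖(solA 𝒢 0 W 0 ε₄ 𝔄₁ + 𝔄₁) - (solA 𝒢 0 W 0 ε₄ 𝔄₀ + 𝔄₀)‖ ≤
      ((θ + 4 * B₀ * C₄ * (ε₄ + a)) / (1 - (θ + 4 * B₀ * C₄ * (ε₄ + a))) + 1) * ‖𝔄₁ - 𝔄₀‖ := by
  have h := norm_solA_sub_solA_le_datum (Λ := 0) (J := 0) R (by simpa using hj) h𝔄₁ h𝔄₀
  have e : (solA 𝒢 0 W 0 ε₄ 𝔄₁ + 𝔄₁) - (solA 𝒢 0 W 0 ε₄ 𝔄₀ + 𝔄₀) = (solA 𝒢 0 W 0 ε₄ 𝔄₁ - solA 𝒢 0 W 0 ε₄ 𝔄₀) + (𝔄₁ - 𝔄₀) := by abel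
  rw [e, add_mul, one_mul]
  exact (norm_add_le _ _).trans (add_le_add h le_rfl)

/-- **`‖WY₁ − WY₀‖ ≤ 4C₄(ε₄ + a)‖Y₁ − Y₀‖`** on the ball `ε₄ + a` (the Cauchy-estimate contraction bound (119)–(120), b2b's `quadAnalytic_norm_sub_le` BY NAME).
[cite: Balaban1985Variational, (119)-(120) p.295] -/
theorem norm_W_diff_le (R : Regime 𝒢 0 W B₀ θ C₄ a₃ j a ε₄) (hj : 0 ≤ j) {𝔄₁ 𝔄₀ : 𝒴} (h𝔄₁ : ‖𝔄₁‖ < a) (h𝔄₀ : ‖𝔄₀‖ < a) :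
    ‖W (solA 𝒢 0 W 0 ε₄ 𝔄₁ + 𝔄₁) - W (solA 𝒢 0 W 0 ε₄ 𝔄₀ + 𝔄₀)‖ ≤
      4 * C₄ * (ε₄ + a) * ‖(solA 𝒢 0 W 0 ε₄ 𝔄₁ + 𝔄₁) - (solA 𝒢 0 W 0 ε₄ 𝔄₀ + 𝔄₀)‖ :=
  quadAnalytic_norm_sub_le R.quad R.C₄_nonneg R.dom (norm_arg_chart_lt R hj h𝔄₁) (norm_arg_chart_lt R hj h𝔄₀)

end Scheme

/-! ## §2. At a charted run: (J2)×2 and (J3) from the displayed smoothing laws -/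

section Pin

variable {P : Params} {N M : ℕ} {𝒴 𝒵 : Type} [NormedAddCommGroup 𝒴] [NormedSpace ℂ 𝒴] [NormedAddCommGroup 𝒵] [NormedSpace ℂ 𝒵] [CompleteSpace 𝒴]
  {Rz : Sect2.Residual P (MatA N)} {cB : ℝ} {χ : ChartB12Run P N M 𝒴 𝒵}

omit [CompleteSpace 𝒴] in
/-- `∂^{ξ*}π∂^ξ ∘ ev` is subtractive (module r20's `lapCur_sub` + linearity of the presentation). [cite: Balaban1987RG1, (3.11) p.272 (bookkeeping)] -/
theorem lapCur_ev_sub (ξ : ℝ) (Y Y' : 𝒴) (b : PBond P 0) :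
    lapCur (slProj N) ξ (1 : PBond P 0 → (MatA N)ˣ) (χ.ev (Y - Y')) b =
      lapCur (slProj N) ξ (1 : PBond P 0 → (MatA N)ˣ) (χ.ev Y) b - lapCur (slProj N) ξ (1 : PBond P 0 → (MatA N)ˣ) (χ.ev Y') b := by
  rw [map_sub, lapCur_sub]

omit [CompleteSpace 𝒴] in
/-- `∂^{ξ*}π∂^ξ ∘ ev` is additive. [cite: Balaban1987RG1, (3.11) p.272 (bookkeeping)] -/
theorem lapCur_ev_add (ξ : ℝ) (Y Y' : 𝒴) (b : PBond P 0) :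
    lapCur (slProj N) ξ (1 : PBond P 0 → (MatA N)ˣ) (χ.ev (Y + Y')) b =
      lapCur (slProj N) ξ (1 : PBond P 0 → (MatA N)ˣ) (χ.ev Y) b + lapCur (slProj N) ξ (1 : PBond P 0 → (MatA N)ˣ) (χ.ev Y') b := by
  rw [map_add, lapCur_add]

/-- **(J2) `hS` AT THE CHART PIN** — `‖∂^{ξ*}π∂^ξ(𝐇 − H₁)(b)‖ < βα₀(L^{j−1}η)²` for the charted `𝐇 = ev 𝓗(𝔄)`, `H₁ = ev 𝔄` (every bond; a fortiori on `Y = □̃³`): by §1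
`𝐇 − H₁ = ev(TY − Y) − ev(𝔊(WY))`, the displayed smoothing laws `lapT` ([15] (47)∕(177): `T − id = −HD` of second order in the `∂^{ξ*}π∂^ξ`-seminorm) and `lapG` ([15] (117) ∕ [5] Thm 3.13:
`𝔊` gains two derivatives), `‖WY‖ ≤ C₄(ε₄ + a)²`, and the constant line `hJ2`. [cite: Balaban1987RG1, p.279 («for the second order operator ∂^{ξ*}∂^ξ»), (3.45) p.279]
[cite: Balaban1985Variational, (174)-(175) p.305, (117) p.295, (47) p.287] -/
theorem hS_of_chart (laws : ChartB12Laws Rz cB χ) {BG KL : ℝ} (hBG : 0 ≤ BG) (hKL : 0 ≤ KL)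
    (lapG : ∀ (f : 𝒵) (b : PBond P 0), ‖lapCur (slProj N) (χ.toResid.csX cB).ξ (1 : PBond P 0 → (MatA N)ˣ) (χ.ev (χ.𝒢 f)) b‖ ≤ BG * ‖f‖)
    (lapT : ∀ Y : 𝒴, ‖Y‖ < χ.ε₄ + χ.a → ∀ b : PBond P 0,
      ‖lapCur (slProj N) (χ.toResid.csX cB).ξ (1 : PBond P 0 → (MatA N)ˣ) (χ.ev (χ.T Y - Y)) b‖ ≤ KL * ‖Y‖ ^ 2)
    (hJ2 : (KL + BG * χ.C₄) * (χ.ε₄ + χ.a) ^ 2 <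
      χ.toResid.consts.β * χ.toResid.consts.α₀ * (χ.toResid.consts.L ^ (χ.toResid.idx.j - 1) * χ.toResid.idx.η) ^ 2)
    {Φ : FieldPair P 0 (MatA N)ˣ (MatA N)} {A : PBond P 0 → MatA N}
    (hΦ : Φ ∈ space (suModel N) (χ.toResid.frameBox Rz) (χ.toResid.csBox cB) ((1 + 2 * χ.toResid.consts.β) * χ.toResid.consts.α₀)
      ((1 + 2 * χ.toResid.consts.β) * χ.toResid.consts.α₁) χ.toResid.α₀)
    (hA : A ∈ χ.toResid.A331) :
    ∀ b ∈ χ.toResid.regionY.bonds, ‖lapCur (slProj N) (χ.toResid.csX cB).ξ (1 : PBond P 0 → (MatA N)ˣ) (χ.H Φ A - χ.H₁ Φ A) b‖ <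
      χ.toResid.consts.β * χ.toResid.consts.α₀ * (χ.toResid.consts.L ^ (χ.toResid.idx.j - 1) * χ.toResid.idx.η) ^ 2 := by
  intro b _
  have h𝔄 : ‖χ.dat Φ A‖ < χ.a := laws.dat_lt Φ A hΦ hA
  set Y : 𝒴 := solA χ.𝒢 0 χ.W 0 χ.ε₄ (χ.dat Φ A) + χ.dat Φ A with hY
  have hYlt : ‖Y‖ < χ.ε₄ + χ.a := norm_arg_chart_lt laws.regime laws.jc_nonneg h𝔄
  have hW : ‖χ.W Y‖ ≤ χ.C₄ * (χ.ε₄ + χ.a) ^ 2 := norm_W_arg_le laws.regime laws.jc_nonneg h𝔄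
  have e : χ.H Φ A - χ.H₁ Φ A = χ.ev ((χ.T Y - Y) - χ.𝒢 (χ.W Y)) := by
    show (fun b => χ.ev (chartH χ.𝒢 0 χ.W 0 χ.T χ.ε₄ (χ.dat Φ A)) b) - (fun b => χ.ev (χ.dat Φ A) b) = _
    rw [← chartH_sub_self_eq (T := χ.T) laws.regime laws.jc_nonneg h𝔄, map_sub]
  rw [e, lapCur_ev_sub]
  have h1 := lapT Y hYlt b
  have h2 := lapG (χ.W Y) b
  have hY2 : ‖Y‖ ^ 2 ≤ (χ.ε₄ + χ.a) ^ 2 := pow_le_pow_left₀ (norm_nonneg _) hYlt.le 2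
  calc ‖lapCur (slProj N) (χ.toResid.csX cB).ξ 1 (χ.ev (χ.T Y - Y)) b - lapCur (slProj N) (χ.toResid.csX cB).ξ 1 (χ.ev (χ.𝒢 (χ.W Y))) b‖
      ≤ KL * ‖Y‖ ^ 2 + BG * ‖χ.W Y‖ := (norm_sub_le _ _).trans (add_le_add h1 h2)
    _ ≤ KL * (χ.ε₄ + χ.a) ^ 2 + BG * (χ.C₄ * (χ.ε₄ + χ.a) ^ 2) :=
        add_le_add (mul_le_mul_of_nonneg_left hY2 hKL) (mul_le_mul_of_nonneg_left hW hBG)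
    _ = (KL + BG * χ.C₄) * (χ.ε₄ + χ.a) ^ 2 := by ring
    _ < _ := hJ2

/-- **(J2) `hSτ` AT THE CHART PIN** — `‖∂^{ξ*}π∂^ξ(𝐊 − τH₁)(b)‖ < βα₀(L^{j−1}η)²` for the charted `𝐊 = ev 𝓗(τ𝔄)`, `τ ∈ [0, 1]`: `hS_of_chart`'s argument at the datum `τ𝔄` (`‖τ𝔄‖ < a`).
[cite: Balaban1987RG1, p.279 («we obtain (3.44) with τQ(…)», «for the second order operator ∂^{ξ*}∂^ξ»)] [cite: Balaban1985Variational, (174)-(175) p.305, (117) p.295] -/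
theorem hSτ_of_chart (laws : ChartB12Laws Rz cB χ) {BG KL : ℝ} (hBG : 0 ≤ BG) (hKL : 0 ≤ KL)
    (lapG : ∀ (f : 𝒵) (b : PBond P 0), ‖lapCur (slProj N) (χ.toResid.csX cB).ξ (1 : PBond P 0 → (MatA N)ˣ) (χ.ev (χ.𝒢 f)) b‖ ≤ BG * ‖f‖)
    (lapT : ∀ Y : 𝒴, ‖Y‖ < χ.ε₄ + χ.a → ∀ b : PBond P 0,
      ‖lapCur (slProj N) (χ.toResid.csX cB).ξ (1 : PBond P 0 → (MatA N)ˣ) (χ.ev (χ.T Y - Y)) b‖ ≤ KL * ‖Y‖ ^ 2)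
    (hJ2 : (KL + BG * χ.C₄) * (χ.ε₄ + χ.a) ^ 2 <
      χ.toResid.consts.β * χ.toResid.consts.α₀ * (χ.toResid.consts.L ^ (χ.toResid.idx.j - 1) * χ.toResid.idx.η) ^ 2)
    {Φ : FieldPair P 0 (MatA N)ˣ (MatA N)} {A : PBond P 0 → MatA N} {τ : ℝ}
    (hΦ : Φ ∈ space (suModel N) (χ.toResid.frameBox Rz) (χ.toResid.csBox cB) ((1 + 2 * χ.toResid.consts.β) * χ.toResid.consts.α₀)
      ((1 + 2 * χ.toResid.consts.β) * χ.toResid.consts.α₁) χ.toResid.α₀)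
    (hA : A ∈ χ.toResid.A331) (hτ0 : 0 ≤ τ) (hτ1 : τ ≤ 1) :
    ∀ b ∈ χ.toResid.regionY.bonds, ‖lapCur (slProj N) (χ.toResid.csX cB).ξ (1 : PBond P 0 → (MatA N)ˣ) (χ.K Φ A τ - (τ : ℂ) • χ.H₁ Φ A) b‖ <
      χ.toResid.consts.β * χ.toResid.consts.α₀ * (χ.toResid.consts.L ^ (χ.toResid.idx.j - 1) * χ.toResid.idx.η) ^ 2 := by
  intro b _
  have h𝔄 : ‖(τ : ℂ) • χ.dat Φ A‖ < χ.a := laws.norm_smul_dat_lt hΦ hA hτ0 hτ1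
  set Y : 𝒴 := solA χ.𝒢 0 χ.W 0 χ.ε₄ ((τ : ℂ) • χ.dat Φ A) + (τ : ℂ) • χ.dat Φ A with hY
  have hYlt : ‖Y‖ < χ.ε₄ + χ.a := norm_arg_chart_lt laws.regime laws.jc_nonneg h𝔄
  have hW : ‖χ.W Y‖ ≤ χ.C₄ * (χ.ε₄ + χ.a) ^ 2 := norm_W_arg_le laws.regime laws.jc_nonneg h𝔄
  have e : χ.K Φ A τ - (τ : ℂ) • χ.H₁ Φ A = χ.ev ((χ.T Y - Y) - χ.𝒢 (χ.W Y)) := by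
    show (fun b => χ.ev (chartH χ.𝒢 0 χ.W 0 χ.T χ.ε₄ ((τ : ℂ) • χ.dat Φ A)) b) - (τ : ℂ) • (fun b => χ.ev (χ.dat Φ A) b) = _
    rw [← chartH_sub_self_eq (T := χ.T) laws.regime laws.jc_nonneg h𝔄, map_sub, map_smul]
  rw [e, lapCur_ev_sub]
  have h1 := lapT Y hYlt b
  have h2 := lapG (χ.W Y) b
  have hY2 : ‖Y‖ ^ 2 ≤ (χ.ε₄ + χ.a) ^ 2 := pow_le_pow_left₀ (norm_nonneg _) hYlt.le 2
  calc ‖lapCur (slProj N) (χ.toResid.csX cB).ξ 1 (χ.ev (χ.T Y - Y)) b - lapCur (slProj N) (χ.toResid.csX cB).ξ 1 (χ.ev (χ.𝒢 (χ.W Y))) b‖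
      ≤ KL * ‖Y‖ ^ 2 + BG * ‖χ.W Y‖ := (norm_sub_le _ _).trans (add_le_add h1 h2)
    _ ≤ KL * (χ.ε₄ + χ.a) ^ 2 + BG * (χ.C₄ * (χ.ε₄ + χ.a) ^ 2) :=
        add_le_add (mul_le_mul_of_nonneg_left hY2 hKL) (mul_le_mul_of_nonneg_left hW hBG)
    _ = (KL + BG * χ.C₄) * (χ.ε₄ + χ.a) ^ 2 := by ring
    _ < _ := hJ2

/-- **(J3) `hA2` AT THE CHART PIN** — `‖∂^{ξ*}π∂^ξ𝐀₂(b)‖ ≤ B₃″·‖B′‖` for the charted increment `𝐀₂ = ev(𝓗(τ𝔄 + H_{1,j}B′) − 𝓗(τ𝔄))` on the printed domain: by §1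
`𝓗(𝔄₁) − 𝓗(𝔄₀) = ((TY₁ − Y₁) − (TY₀ − Y₀)) − 𝔊(WY₁ − WY₀) + H_{1,j}B′`, the displayed laws `lapTlip` ([15] (47)∕(190): the second-order part is Lipschitz in the
`∂^{ξ*}π∂^ξ`-seminorm), `lapG` ([15] (117)), `lapLin` ([15] (103): `H_{1,j}` maps into the seminorm), the bounds `‖WY₁ − WY₀‖ ≤ 4C₄(ε₄ + a)‖Y₁ − Y₀‖` ((119)–(120)),
`‖Y₁ − Y₀‖ ≤ (κ∕(1−κ) + 1)‖H_{1,j}‖‖B′‖`, and the constant line `hJ3`. [cite: Balaban1987RG1, (3.50) pp.279-280] [cite: Balaban1985Variational, (174)-(175) p.305, (117) p.295, (190) p.308] -/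
theorem hA2_of_chart (laws : ChartB12Laws Rz cB χ) {BG KL' BH : ℝ} (hBG : 0 ≤ BG) (hKL' : 0 ≤ KL')
    (lapG : ∀ (f : 𝒵) (b : PBond P 0), ‖lapCur (slProj N) (χ.toResid.csX cB).ξ (1 : PBond P 0 → (MatA N)ˣ) (χ.ev (χ.𝒢 f)) b‖ ≤ BG * ‖f‖)
    (lapTlip : ∀ x y : 𝒴, ‖x‖ < χ.ε₄ + χ.a → ‖y‖ < χ.ε₄ + χ.a → ∀ b : PBond P 0,
      ‖lapCur (slProj N) (χ.toResid.csX cB).ξ (1 : PBond P 0 → (MatA N)ˣ) (χ.ev ((χ.T x - x) - (χ.T y - y))) b‖ ≤ KL' * ‖x - y‖)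
    (lapLin : ∀ (B' : PBond P 0 → MatA N) (b : PBond P 0),
      ‖lapCur (slProj N) (χ.toResid.csX cB).ξ (1 : PBond P 0 → (MatA N)ˣ) (χ.ev (χ.lin B')) b‖ ≤ BH * ‖B'‖)
    (hJ3 : (KL' + BG * (4 * χ.C₄ * (χ.ε₄ + χ.a))) *
        (((χ.θ + 4 * χ.B₀ * χ.C₄ * (χ.ε₄ + χ.a)) / (1 - (χ.θ + 4 * χ.B₀ * χ.C₄ * (χ.ε₄ + χ.a))) + 1) * ‖χ.lin‖) + BH ≤ χ.toResid.B₃'')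
    {Φ : FieldPair P 0 (MatA N)ˣ (MatA N)} {A : PBond P 0 → MatA N} {τ : ℝ} {B' : PBond P 0 → MatA N}
    (hΦ : Φ ∈ space (suModel N) (χ.toResid.frameBox Rz) (χ.toResid.csBox cB) ((1 + 2 * χ.toResid.consts.β) * χ.toResid.consts.α₀)
      ((1 + 2 * χ.toResid.consts.β) * χ.toResid.consts.α₁) χ.toResid.α₀)
    (hA : A ∈ χ.toResid.A331) (hτ0 : 0 ≤ τ) (hτ1 : τ ≤ 1) (hB' : ‖B'‖ < χ.toResid.consts.α₃) :
    ∀ b ∈ χ.toResid.regionY.bonds, ‖lapCur (slProj N) (χ.toResid.csX cB).ξ (1 : PBond P 0 → (MatA N)ˣ) (χ.A₂ Φ A τ B') b‖ ≤ χ.toResid.B₃'' * ‖B'‖ := by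
  intro b _
  have h𝔄₀ : ‖(τ : ℂ) • χ.dat Φ A‖ < χ.a := laws.norm_smul_dat_lt hΦ hA hτ0 hτ1
  have h𝔄₁ : ‖(τ : ℂ) • χ.dat Φ A + χ.lin B'‖ < χ.a := laws.dat_lin_lt Φ A τ B' hΦ hA hτ0 hτ1 hB'
  set 𝔄₀ : 𝒴 := (τ : ℂ) • χ.dat Φ A with h𝔄₀d
  set 𝔄₁ : 𝒴 := (τ : ℂ) • χ.dat Φ A + χ.lin B' with h𝔄₁d
  set Y₀ : 𝒴 := solA χ.𝒢 0 χ.W 0 χ.ε₄ 𝔄₀ + 𝔄₀ with hY₀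
  set Y₁ : 𝒴 := solA χ.𝒢 0 χ.W 0 χ.ε₄ 𝔄₁ + 𝔄₁ with hY₁
  have hY₀lt : ‖Y₀‖ < χ.ε₄ + χ.a := norm_arg_chart_lt laws.regime laws.jc_nonneg h𝔄₀
  have hY₁lt : ‖Y₁‖ < χ.ε₄ + χ.a := norm_arg_chart_lt laws.regime laws.jc_nonneg h𝔄₁
  have hd𝔄 : 𝔄₁ - 𝔄₀ = χ.lin B' := by rw [h𝔄₁d, h𝔄₀d]; abel
  have e : χ.A₂ Φ A τ B' = χ.ev (((χ.T Y₁ - Y₁) - (χ.T Y₀ - Y₀)) - χ.𝒢 (χ.W Y₁ - χ.W Y₀) + χ.lin B') := by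
    show (fun b => χ.ev (chartH χ.𝒢 0 χ.W 0 χ.T χ.ε₄ 𝔄₁ - chartH χ.𝒢 0 χ.W 0 χ.T χ.ε₄ 𝔄₀) b) = _
    rw [chartH_sub_chartH_eq (T := χ.T) laws.regime laws.jc_nonneg h𝔄₁ h𝔄₀, hd𝔄]
  rw [e, lapCur_ev_add, lapCur_ev_sub]
  have h1 := lapTlip Y₁ Y₀ hY₁lt hY₀lt b
  have h2 := lapG (χ.W Y₁ - χ.W Y₀) b
  have h3 := lapLin B' b
  have hWd : ‖χ.W Y₁ - χ.W Y₀‖ ≤ 4 * χ.C₄ * (χ.ε₄ + χ.a) * ‖Y₁ - Y₀‖ := norm_W_diff_le laws.regime laws.jc_nonneg h𝔄₁ h𝔄₀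
  have hYd : ‖Y₁ - Y₀‖ ≤ ((χ.θ + 4 * χ.B₀ * χ.C₄ * (χ.ε₄ + χ.a)) / (1 - (χ.θ + 4 * χ.B₀ * χ.C₄ * (χ.ε₄ + χ.a))) + 1) * ‖𝔄₁ - 𝔄₀‖ :=
    norm_argDiff_le laws.regime laws.jc_nonneg h𝔄₁ h𝔄₀
  have hlinB : ‖𝔄₁ - 𝔄₀‖ ≤ ‖χ.lin‖ * ‖B'‖ := by rw [hd𝔄]; exact χ.lin.le_opNorm B'
  have hfac : 0 ≤ ((χ.θ + 4 * χ.B₀ * χ.C₄ * (χ.ε₄ + χ.a)) / (1 - (χ.θ + 4 * χ.B₀ * χ.C₄ * (χ.ε₄ + χ.a))) + 1) := by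
    have h := B12Lemma4ChartSizes.lipConst_nonneg laws.regime ((norm_nonneg _).trans_lt h𝔄₀) zero_le_one
    simpa using h
  have hm : 0 ≤ χ.ε₄ + χ.a := by linarith [laws.regime.ε₄_nonneg, (norm_nonneg _).trans_lt h𝔄₀]
  have hC₄ := laws.regime.C₄_nonneg
  have hYB : ‖Y₁ - Y₀‖ ≤ (((χ.θ + 4 * χ.B₀ * χ.C₄ * (χ.ε₄ + χ.a)) / (1 - (χ.θ + 4 * χ.B₀ * χ.C₄ * (χ.ε₄ + χ.a))) + 1) * ‖χ.lin‖) * ‖B'‖ := by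
    calc ‖Y₁ - Y₀‖ ≤ _ := hYd
      _ ≤ ((χ.θ + 4 * χ.B₀ * χ.C₄ * (χ.ε₄ + χ.a)) / (1 - (χ.θ + 4 * χ.B₀ * χ.C₄ * (χ.ε₄ + χ.a))) + 1) * (‖χ.lin‖ * ‖B'‖) :=
          mul_le_mul_of_nonneg_left hlinB hfac
      _ = _ := by ring
  set Λ₀ : ℝ := ((χ.θ + 4 * χ.B₀ * χ.C₄ * (χ.ε₄ + χ.a)) / (1 - (χ.θ + 4 * χ.B₀ * χ.C₄ * (χ.ε₄ + χ.a))) + 1) * ‖χ.lin‖ with hΛ₀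
  have hΛ₀0 : 0 ≤ Λ₀ := mul_nonneg hfac (norm_nonneg χ.lin)
  calc ‖lapCur (slProj N) (χ.toResid.csX cB).ξ 1 (χ.ev ((χ.T Y₁ - Y₁) - (χ.T Y₀ - Y₀))) b -
          lapCur (slProj N) (χ.toResid.csX cB).ξ 1 (χ.ev (χ.𝒢 (χ.W Y₁ - χ.W Y₀))) b +
          lapCur (slProj N) (χ.toResid.csX cB).ξ 1 (χ.ev (χ.lin B')) b‖
      ≤ KL' * ‖Y₁ - Y₀‖ + BG * ‖χ.W Y₁ - χ.W Y₀‖ + BH * ‖B'‖ := by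
        refine (norm_add_le _ _).trans (add_le_add ((norm_sub_le _ _).trans (add_le_add h1 h2)) h3)
    _ ≤ KL' * (Λ₀ * ‖B'‖) + BG * (4 * χ.C₄ * (χ.ε₄ + χ.a) * (Λ₀ * ‖B'‖)) + BH * ‖B'‖ := by
        have e1 : KL' * ‖Y₁ - Y₀‖ ≤ KL' * (Λ₀ * ‖B'‖) := mul_le_mul_of_nonneg_left hYB hKL'
        have e2 : BG * ‖χ.W Y₁ - χ.W Y₀‖ ≤ BG * (4 * χ.C₄ * (χ.ε₄ + χ.a) * (Λ₀ * ‖B'‖)) :=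
          mul_le_mul_of_nonneg_left (hWd.trans (mul_le_mul_of_nonneg_left hYB (mul_nonneg (mul_nonneg (by norm_num) hC₄) hm))) hBG
        linarith
    _ = ((KL' + BG * (4 * χ.C₄ * (χ.ε₄ + χ.a))) * Λ₀ + BH) * ‖B'‖ := by ring
    _ ≤ χ.toResid.B₃'' * ‖B'‖ := mul_le_mul_of_nonneg_right hJ3 (norm_nonneg _)

end Pin

/-! ## §3. One closer: Lemma 4 at the group of record from the chart laws, the smoothing laws, the analyticity letters and the residue MODULO its three sizes -/

section Closer

variable {P : Params} {N M : ℕ} {𝒴 𝒵 : Type} [NormedAddCommGroup 𝒴] [NormedSpace ℂ 𝒴] [NormedAddCommGroup 𝒵] [NormedSpace ℂ 𝒵]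
  [CompleteSpace 𝒴] [CompleteSpace 𝒵] {Rz : Sect2.Residual P (MatA N)} {cB : ℝ} {χ : ChartB12Run P N M 𝒴 𝒵}

/-- **LEMMA 4 (3.53) AT THE GROUP OF RECORD OF A CHARTED RUN — ONE CLOSER WHOSE DISPLAYED HYPOTHESES ARE THE HONEST RESIDUE**: the chart laws (module D), the four
smoothing laws + two constant lines (§2), the analyticity of `W`, `T` and of the coarse datum (my `…N09ChartLettersAnalytic`), «X ⊂ □̃²», the seven restrictions, `0 < cB`, and
the by-reference residue `JInputsRef` MODULO ITS THREE SIZE FIELDS — supplied as a function that receives the (J2)×2 ∕ (J3) sizes proved here and returns the residue (upper-space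
datum (3.40), gauge transformations with their costs, identities (3.38)∕(3.39)+(3.37)∕(3.42): [12]∕[14]∕[15] statements = N04∕N07 in-edges).  = `leaf_of_chart_of_analytic` ∘ §2.
NOT a discharge of N09; count-neutral. [cite: Balaban1987RG1, Lemma 4 (3.53) p.280 with (3.26)-(3.52) pp.275-280, p.279] [cite: Balaban1985Variational, Prop. 9 p.309, (117) p.295] -/
theorem leaf_of_chart_of_smoothing [NeZero N] (laws : ChartB12Laws Rz cB χ) (hX : χ.idx.XSites ⊆ χ.idx.boxT 2)
    (hB : 1 ≤ χ.toResid.consts.B₃) (hY : 1 ≤ χ.toResid.consts.B₃ ^ 2 * χ.toResid.consts.O₁ * χ.toResid.consts.M)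
    (hα₁ : 16 * (χ.toResid.consts.O₁ * χ.toResid.consts.M * χ.toResid.consts.α₁) ≤ χ.toResid.consts.β)
    (hL10 : 1 + 10 * χ.toResid.consts.β ≤ χ.toResid.consts.L ^ 2) (hB'' : 0 ≤ χ.toResid.B₃'')
    (hres'' : χ.toResid.B₃'' * χ.toResid.consts.α₃ ≤ χ.toResid.consts.β * χ.toResid.consts.L⁻¹ ^ 2 * χ.toResid.consts.α₀)
    (hresJ : 4 * ((P.d - 1) * ((2 : ℝ) * B12Eq311CurrentExpansion.C311 1)) * (χ.toResid.consts.B₃ ^ 2 * χ.toResid.consts.O₁ * χ.toResid.consts.M) ^ 2 *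
      χ.toResid.consts.α₀ ≤ χ.toResid.consts.β)
    {BG KL KL' BH : ℝ} (hBG : 0 ≤ BG) (hKL : 0 ≤ KL) (hKL' : 0 ≤ KL')
    (lapG : ∀ (f : 𝒵) (b : PBond P 0), ‖lapCur (slProj N) (χ.toResid.csX cB).ξ (1 : PBond P 0 → (MatA N)ˣ) (χ.ev (χ.𝒢 f)) b‖ ≤ BG * ‖f‖)
    (lapT : ∀ Y : 𝒴, ‖Y‖ < χ.ε₄ + χ.a → ∀ b : PBond P 0,
      ‖lapCur (slProj N) (χ.toResid.csX cB).ξ (1 : PBond P 0 → (MatA N)ˣ) (χ.ev (χ.T Y - Y)) b‖ ≤ KL * ‖Y‖ ^ 2)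
    (lapTlip : ∀ x y : 𝒴, ‖x‖ < χ.ε₄ + χ.a → ‖y‖ < χ.ε₄ + χ.a → ∀ b : PBond P 0,
      ‖lapCur (slProj N) (χ.toResid.csX cB).ξ (1 : PBond P 0 → (MatA N)ˣ) (χ.ev ((χ.T x - x) - (χ.T y - y))) b‖ ≤ KL' * ‖x - y‖)
    (lapLin : ∀ (B' : PBond P 0 → MatA N) (b : PBond P 0),
      ‖lapCur (slProj N) (χ.toResid.csX cB).ξ (1 : PBond P 0 → (MatA N)ˣ) (χ.ev (χ.lin B')) b‖ ≤ BH * ‖B'‖)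
    (hJ2 : (KL + BG * χ.C₄) * (χ.ε₄ + χ.a) ^ 2 <
      χ.toResid.consts.β * χ.toResid.consts.α₀ * (χ.toResid.consts.L ^ (χ.toResid.idx.j - 1) * χ.toResid.idx.η) ^ 2)
    (hJ3 : (KL' + BG * (4 * χ.C₄ * (χ.ε₄ + χ.a))) *
        (((χ.θ + 4 * χ.B₀ * χ.C₄ * (χ.ε₄ + χ.a)) / (1 - (χ.θ + 4 * χ.B₀ * χ.C₄ * (χ.ε₄ + χ.a))) + 1) * ‖χ.lin‖) + BH ≤ χ.toResid.B₃'')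
    (inputsRef : ∀ (Φ : FieldPair P 0 (MatA N)ˣ (MatA N)) (A : PBond P 0 → MatA N) (τ : ℝ) (B' : PBond P 0 → MatA N),
      Φ ∈ space (suModel N) (χ.toResid.frameBox Rz) (χ.toResid.csBox cB) ((1 + 2 * χ.toResid.consts.β) * χ.toResid.consts.α₀)
          ((1 + 2 * χ.toResid.consts.β) * χ.toResid.consts.α₁) χ.toResid.α₀ →
        A ∈ χ.toResid.A331 → 0 ≤ τ → τ ≤ 1 → ‖B'‖ < χ.toResid.consts.α₃ →
        (∀ b ∈ χ.toResid.regionY.bonds, ‖lapCur (slProj N) (χ.toResid.csX cB).ξ (1 : PBond P 0 → (MatA N)ˣ) (χ.H Φ A - χ.H₁ Φ A) b‖ <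
          χ.toResid.consts.β * χ.toResid.consts.α₀ * (χ.toResid.consts.L ^ (χ.toResid.idx.j - 1) * χ.toResid.idx.η) ^ 2) →
        (∀ b ∈ χ.toResid.regionY.bonds, ‖lapCur (slProj N) (χ.toResid.csX cB).ξ (1 : PBond P 0 → (MatA N)ˣ) (χ.K Φ A τ - (τ : ℂ) • χ.H₁ Φ A) b‖ <
          χ.toResid.consts.β * χ.toResid.consts.α₀ * (χ.toResid.consts.L ^ (χ.toResid.idx.j - 1) * χ.toResid.idx.η) ^ 2) →
        (∀ b ∈ χ.toResid.regionY.bonds, ‖lapCur (slProj N) (χ.toResid.csX cB).ξ (1 : PBond P 0 → (MatA N)ˣ) (χ.A₂ Φ A τ B') b‖ ≤ χ.toResid.B₃'' * ‖B'‖) →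
          JInputsRef (suModel N) χ.toResid.consts (χ.toResid.frameX Rz) (χ.toResid.frameBox Rz) (χ.toResid.csX cB) (χ.toResid.csBox cB)
            χ.toResid.regionY (slProj N) χ.toResid.idx.η χ.toResid.B₃'' χ.toResid.α₀ χ.toResid.idx.j τ ‖B'‖ (χ.K Φ A τ) (χ.A₂ Φ A τ B') (χ.H Φ A) (χ.H₁ Φ A))
    (hWa : AnalyticOnNhd ℂ χ.W {Y : 𝒴 | ‖Y‖ < χ.a₃}) (hTa : AnalyticOnNhd ℂ χ.T {Y : 𝒴 | ‖Y‖ < χ.ε₄ + χ.a})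
    (hBan : ∀ {E : Type} [NormedAddCommGroup E] [NormedSpace ℂ E] {Φf : E → FieldPair P 0 (MatA N)ˣ (MatA N)}
      {Af Bf : E → PBond P 0 → MatA N} {e₀ : E}, B12Lemma4ConcreteFrame.LettersAnalyticAt Φf Af Bf e₀ →
        Φf e₀ ∈ space (suModel N) (χ.toResid.frameBox Rz) (χ.toResid.csBox cB) ((1 + 2 * χ.toResid.consts.β) * χ.toResid.consts.α₀)
            ((1 + 2 * χ.toResid.consts.β) * χ.toResid.consts.α₁) χ.toResid.α₀ →
          Af e₀ ∈ χ.toResid.A331 → AnalyticAt ℂ (fun e => χ.fldB (Φf e) (Af e)) e₀)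
    (hcB : 0 < cB) : B12LeafOfRecord Rz cB χ.toResid :=
  N09ChartLettersAnalytic.leaf_of_chart_of_analytic laws hX hB hY hα₁ hL10 hB'' hres'' hresJ
    (fun Φ A τ B' hΦ hA hτ0 hτ1 hB' => inputsRef Φ A τ B' hΦ hA hτ0 hτ1 hB'
      (hS_of_chart laws hBG hKL lapG lapT hJ2 hΦ hA) (hSτ_of_chart laws hBG hKL lapG lapT hJ2 hΦ hA hτ0 hτ1)
      (hA2_of_chart laws hBG hKL' lapG lapTlip lapLin hJ3 hΦ hA hτ0 hτ1 hB'))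
    hWa hTa hBan hcB

end Closer

end Summit.QuantumFields.YangMills.BalabanUVNodes.N09ChartSecondOrderInputs

end
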